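import Summits.QuantumFields.BalabanUV.Beta.FP.PerfectObjectsT
import Summits.QuantumFields.BalabanUV.Beta.SecondOrderUnits
import Literature.MathematicalPhysics.QuantumFieldTheory.Balaban1983to89.Beta.SecondOrderResponse
import Literature.MathematicalPhysics.QuantumFieldTheory.Balaban1983to89.Beta.HessKerRate

/-!
# `BalabanUV.Beta.FP.BiVertexLimit` — road «FP» for binder row D1, `RESIDUAL-FP.md` §9 ROW #14 «W-SLOT SPLIT», THE LIMIT GLUE (owner, gen 10): THE BI-VERTEX
# `vertex2OfK K N S₂` IS LIPSCHITZ IN `(K, S₂)` (one-centre currency), HENCE ITS CONSTRUCTED LIMIT ALONG ANY FAMILY WITH (CONV-C)-TYPE RATES IS THE BI-VERTEX OF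
# THE LIMITS; + its change of leg units; + additivity of constructed limits under entrywise convergence

HONEST DEPENDENCY (page 1, mandatory): continuum YM on T⁴ ⇐ BetaPertH ∧ nine spine estimates (0/9 proved); BetaPertH ⇐ (D1) ∧ (D4) ∧ CAP+tail;
G-an2-4 gates asym, D1 and NE2/3/4.  HONEST FRAMING (cell contract, verbatim): «discharging `BetaPertH` makes Bałaban's UV stability UNCONDITIONAL —
a real constructive-QFT result; it is NOT the continuum limit and NOT the Clay problem.»  THIS MODULE is [folklore] kernel bookkeeping (absolutely
convergent lattice sums; explicit constants; no `def`, no `def … : Prop`, nothing cited, 0 sorry).  Every rate ∕ row below is a HYPOTHESIS SHAPE with free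
constants (X1-type data for a resolvent family and a bi-stencil family), asserted for no object of Bałaban's.  0∕4 row-D1 binders; NOT X1, NOT row #14 for the
literal, NOT (ASYMP), NOT D1, NOT BetaPertH, NOT continuum, NOT Clay.  «not in print; our bookkeeping».

ABSOLUTE RULE (cell charter, verbatim): «No internally-minted statement may enter as a cited fact. Every hypothesis is either kernel-proved in this package or a
verbatim quotation of a PUBLISHED theorem with page reference. The manuscript(s) under audit are NOT citable for their own disputed steps — they are the thing
under adjudication; programme-internal (2001/route/tribunal) claims are never citable.»

WHY.  The road's END at the placement of record (`RoadEndLeft.d1Drift_left_of_step_law_wslot_split`, `RoadLeftAssembly`) displays the W-slot split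
`WPerfOf sf sm Wt m = vertex2OfK (KPerf m) (Lc^m) (Wf m) + Wx m` (row #14).  At finite `j` the literal's second-order slot IS such a sum BY DEFINITION
(`SecondOrderResponse.W2OfK = vertex2OfK + mixOfK + mixOfK′ + dM (K2OfK …)`, an2's `W2SymOfK`).  To pass the split to the perfect objects one needs (a) the bi-vertex
summand in leg units (§1), (b) the LIMIT of the bi-vertex summand = the bi-vertex of the limits (§4: a geometric one-centre `BiLoc` rate from rates of `K_j` and
`S₂,j`, then asym1's uniqueness `limMKerOf_eq_of_biLoc_rate`), (c) additivity of the constructed limit when both summands converge (§5).  After this file row #14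
reads: «⟸ the finite-`j` split (by definition) + X1-type rates for the rescaled resolvents and bi-stencils + entrywise convergence of the remaining summands (EXT)».

CONTENT.
* §1 [folklore] **`unitW_vertex2OfK`** — the family form `unitW sf sm (vertex2OfK K N S₂) = vertex2OfK (unitK sf sm K) N (unitS₂ sf sm S₂)` of the tree's pointwise
  `SecondOrderUnits.vertex2OfK_unit` (cited, not restated).
* §2 [folklore] `locStencil_slice_of_locStencil₂` (re-anchoring a `LocStencil₂` slice at its own second index, half the rate); one-centre weighted sums with
  UNIFORMLY localised tables: `summable_wsum_unif`, `biLoc_wsum_unif`, `biLoc_wsum_sub_unif`.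
* §3 [folklore] the inner vertex `κ u ↦ vertexOfK K N (S₂ κ u) ν y′`: `biLoc_innerVertex` (uniform), `biLoc_innerVertex_sub` (Lipschitz; asym1's
  `HessKerRate.vertexFamily_vertexOfK_sub`).
* §4 [folklore] **`biLoc_vertex2OfK_sub`** (THE BI-VERTEX IS LIPSCHITZ IN `(K, S₂)`, one-centre `BiLoc` at `(N•y′, N•y′)`, explicit constant, rate `m/4`),
  **`biLoc_vertex2OfK_rate`**, **`limTabOf_vertex2OfK_eq`** — under uniform rows + geometric rates of `(K_j, S₂,j)` to `(K∞, S₂∞)` and `0 ≤ θ < 1`,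
  `limTabOf (j ↦ vertex2OfK (K j) N (S₂ j)) = vertex2OfK K∞ N S₂∞`.
* §5 [folklore] `limMKerOf_add_of_tendsto`, **`limTabOf_add_of_tendsto`**, **`limTabOf_split_of_rates`** — the row-#14 glue: `W_j = vertex2OfK (K j) N (S₂ j) + X j` with
  the §4 rates and `X j → X∞` entrywise ⟹ `limTabOf W = vertex2OfK K∞ N S₂∞ + X∞`.
Provenance: road FP OWNER b2b-balaban-beta-d1-p3 gen 10 (prover-b2b-balaban-beta-d1-p3-g10-0), 2026-08-21, row #14.
-/

noncomputable section

namespace Summit.QuantumFields.BalabanUV.Beta.FP.BiVertexLimit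

open Filter Topology
open Literature.MathematicalPhysics.QuantumFieldTheory.Balaban1983to89
open Literature.MathematicalPhysics.QuantumFieldTheory.Balaban1983to89.Beta
open B12Sec2to5 (l1 l1_nonneg)
open ExpKernelCalculus (Site MKer Decays BiLoc VertexFamily Zl Zl_nonneg l1_sub_triangle l1_sub_symm summable_exp_shift tsum_exp_shift)
open OneStepResolventKernel (Fib LocStencil wsum bound_mono biLoc_finset_sum)
open OneStepKernelFamily (colH abs_colH_le vertexOfK vertexFamily_vertexOfK)
open BalabanCompositeJets (LocStencil₂)
open SecondOrderResponse (vertex2OfK)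
open HessKerRate (colH_sub vertexFamily_vertexOfK_sub)
open HessKerDressedLimit (limMKerOf limTabOf limMKerOf_apply limTabOf_apply limMKerOf_eq_of_tendsto limMKerOf_eq_of_biLoc_rate
  tendsto_of_biLoc_rate mker_sub_apply)
open Summit.QuantumFields.BalabanUV.Beta.HessKerDressedUnits (unitK unitS unitW)
open Summit.QuantumFields.BalabanUV.Beta.SecondOrderUnits (unitS₂ vertex2OfK_unit)

/-! ## §1 The bi-vertex in leg units -/

section Units

variable {d : ℕ}

/-- [folklore] **THE BI-VERTEX IN LEG UNITS, FAMILY FORM**: `unitW sf sm (vertex2OfK K N S₂) = vertex2OfK (D K D) N (unitS₂ sf sm S₂)`, `D = diag(s_f ∣ s_m)`,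
`unitS₂ sf sm S₂ κ u = (s_f s_m)⁻¹ • unitS sf sm (S₂ κ u)` — the tree's pointwise `SecondOrderUnits.vertex2OfK_unit` read as an equality of table families.  This is how a
supplier rewrites the bi-vertex summand of the literal's rescaled second-order slot before taking the limit (cf. `SecondOrderUnits.unitW_W2SymOfK`). -/
theorem unitW_vertex2OfK {sf sm : ℝ} (hsf : sf ≠ 0) (hsm : sm ≠ 0) (K : MKer (d + 1) (Fib d)) (N : ℕ)
    (S₂ : Fin (d + 1) → (Fin (d + 1) → ℤ) → Fin (d + 1) → (Fin (d + 1) → ℤ) → MKer (d + 1) (Fib d)) :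
    unitW sf sm (vertex2OfK K N S₂) = vertex2OfK (unitK sf sm K) N (unitS₂ sf sm S₂) :=
  funext fun μ => funext fun y => funext fun ν => funext fun y' => (vertex2OfK_unit hsf hsm K S₂ μ y ν y').symm

end Units

/-! ## §2 Re-anchoring a bi-stencil slice; one-centre weighted sums with uniformly localised tables -/

section Sums

variable {D : ℕ} {F : Type*}

/-- [folklore] **ONE-CENTRE WEIGHTED SUM, UNIFORMLY LOCALISED TABLES — SUMMABILITY**: weights decaying from `p` (rate `m > 0`), tables ALL bi-localised at the
same pair `(q, q′)` ⟹ the superposition series converges absolutely at every entry. -/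
theorem summable_wsum_unif {w : (Fin D → ℤ) → ℝ} {T : (Fin D → ℤ) → MKer D F} {C B m δ' : ℝ} {p q q' : Fin D → ℤ}
    (hw : ∀ u, |w u| ≤ C * Real.exp (-m * l1 (u - p))) (hT : ∀ u, BiLoc (T u) q q' B δ') (hm : 0 < m)
    (x z : Fin D → ℤ) (a b : F) : Summable fun u : Fin D → ℤ => w u * T u x z a b := by
  refine Summable.of_norm_bounded ((summable_exp_shift hm p).mul_left (C * (B * Real.exp (-δ' * (l1 (x - q) + l1 (z - q')))))) fun u => ?_
  rw [Real.norm_eq_abs, abs_mul, l1_sub_symm p u]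
  have h1 := hw u
  have h2 := hT u x z a b
  calc |w u| * |T u x z a b| ≤ (C * Real.exp (-m * l1 (u - p))) * (B * Real.exp (-δ' * (l1 (x - q) + l1 (z - q')))) :=
        mul_le_mul h1 h2 (abs_nonneg _) ((abs_nonneg _).trans h1)
    _ = _ := by ring

/-- [folklore] **ONE-CENTRE WEIGHTED SUM, UNIFORMLY LOCALISED TABLES — BOUND**: `|Σ_u w u · T u| ≤ C·Zl(m)·B · e^{−δ′(|x−q|+|z−q′|)}`. -/
theorem biLoc_wsum_unif {w : (Fin D → ℤ) → ℝ} {T : (Fin D → ℤ) → MKer D F} {C B m δ' : ℝ} {p q q' : Fin D → ℤ}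
    (hw : ∀ u, |w u| ≤ C * Real.exp (-m * l1 (u - p))) (hT : ∀ u, BiLoc (T u) q q' B δ') (hm : 0 < m) :
    BiLoc (wsum w T) q q' (C * Zl D m * B) δ' := by
  intro x z a b
  show |∑' u, w u * T u x z a b| ≤ _
  have hs := (summable_exp_shift hm p).mul_left (C * (B * Real.exp (-δ' * (l1 (x - q) + l1 (z - q')))))
  have hb := tsum_of_norm_bounded (f := fun u => w u * T u x z a b) hs.hasSum (fun u => by
    rw [Real.norm_eq_abs, abs_mul, l1_sub_symm p u]
    have h1 := hw u
    have h2 := hT u x z a b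
    calc |w u| * |T u x z a b| ≤ (C * Real.exp (-m * l1 (u - p))) * (B * Real.exp (-δ' * (l1 (x - q) + l1 (z - q')))) :=
          mul_le_mul h1 h2 (abs_nonneg _) ((abs_nonneg _).trans h1)
      _ = _ := by ring)
  rw [Real.norm_eq_abs] at hb
  refine hb.trans (le_of_eq ?_)
  rw [tsum_mul_left, tsum_exp_shift]
  ring

/-- [folklore] **ONE-CENTRE WEIGHTED SUM — LIPSCHITZ IN (weights, tables)**: deviations `εw` of the weights (same decay from `p`) and `εT` of the tables (same
one-centre localisation) ⟹ `wsum w T − wsum w′ T′` is bi-localised at `(q, q′)` with constant `(εw·B + C′·εT)·Zl(m)`. -/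
theorem biLoc_wsum_sub_unif {w w' : (Fin D → ℤ) → ℝ} {T T' : (Fin D → ℤ) → MKer D F} {C C' εw B B' εT m δ' : ℝ} {p q q' : Fin D → ℤ}
    (hw : ∀ u, |w u| ≤ C * Real.exp (-m * l1 (u - p))) (hw' : ∀ u, |w' u| ≤ C' * Real.exp (-m * l1 (u - p)))
    (hww : ∀ u, |w u - w' u| ≤ εw * Real.exp (-m * l1 (u - p)))
    (hT : ∀ u, BiLoc (T u) q q' B δ') (hT' : ∀ u, BiLoc (T' u) q q' B' δ') (hTT : ∀ u, BiLoc (T u - T' u) q q' εT δ') (hm : 0 < m) :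
    BiLoc (wsum w T - wsum w' T') q q' ((εw * B + C' * εT) * Zl D m) δ' := by
  intro x z a b
  have hs := summable_wsum_unif hw hT hm x z a b
  have hs' := summable_wsum_unif hw' hT' hm x z a b
  have e : (wsum w T - wsum w' T') x z a b = ∑' u, (w u * T u x z a b - w' u * T' u x z a b) := by
    show (∑' u, w u * T u x z a b) - (∑' u, w' u * T' u x z a b) = _
    rw [hs.tsum_sub hs']
  rw [e]
  have hC' : ∀ u, 0 ≤ C' * Real.exp (-m * l1 (u - p)) := fun u => (abs_nonneg _).trans (hw' u)
  have hmaj := (summable_exp_shift hm p).mul_left ((εw * B + C' * εT) * Real.exp (-δ' * (l1 (x - q) + l1 (z - q'))))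
  have hb := tsum_of_norm_bounded (f := fun u => w u * T u x z a b - w' u * T' u x z a b) hmaj.hasSum (fun u => by
    rw [Real.norm_eq_abs, l1_sub_symm p u]
    have h1 := hww u
    have h2 := hT u x z a b
    have h3 := hw' u
    have h4 := hTT u x z a b
    rw [mker_sub_apply] at h4
    have eq : w u * T u x z a b - w' u * T' u x z a b =
        (w u - w' u) * T u x z a b + w' u * (T u x z a b - T' u x z a b) := by ring
    rw [eq]
    calc |(w u - w' u) * T u x z a b + w' u * (T u x z a b - T' u x z a b)|
        ≤ |w u - w' u| * |T u x z a b| + |w' u| * |T u x z a b - T' u x z a b| := by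
          refine (abs_add_le _ _).trans (le_of_eq ?_); rw [abs_mul, abs_mul]
      _ ≤ (εw * Real.exp (-m * l1 (u - p))) * (B * Real.exp (-δ' * (l1 (x - q) + l1 (z - q')))) +
            (C' * Real.exp (-m * l1 (u - p))) * (εT * Real.exp (-δ' * (l1 (x - q) + l1 (z - q')))) :=
          add_le_add (mul_le_mul h1 h2 (abs_nonneg _) ((abs_nonneg _).trans h1)) (mul_le_mul h3 h4 (abs_nonneg _) (hC' u))
      _ = _ := by ring)
  rw [Real.norm_eq_abs] at hb
  refine hb.trans (le_of_eq ?_)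
  rw [tsum_mul_left, tsum_exp_shift]
  ring

end Sums

/-! ## §3 The inner vertex of a bi-stencil family -/

section Inner

variable {d : ℕ} {N : ℕ}

/-- [folklore] **RE-ANCHORING A BI-STENCIL SLICE**: a `LocStencil₂` family (bi-localised at its FIRST index `u`, constant decaying in `|u′ − u|`) is, slice by
slice `κ u`, a `LocStencil` in its SECOND index at HALF the rate: `BiLoc (S₂ κ u κ′ u′) u′ u′ C₂ (m/2)` (triangle inequality). -/
theorem locStencil_slice_of_locStencil₂ {S₂ : Fin (d + 1) → (Fin (d + 1) → ℤ) → Fin (d + 1) → (Fin (d + 1) → ℤ) → MKer (d + 1) (Fib d)}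
    {C₂ m : ℝ} (hS₂ : LocStencil₂ S₂ C₂ m) (hm : 0 ≤ m) (κ : Fin (d + 1)) (u : Fin (d + 1) → ℤ) : LocStencil (S₂ κ u) C₂ (m / 2) := by
  have hC₂ := hS₂.nonneg
  intro κ' u' x y a b
  have h := hS₂ κ u κ' u' x y a b
  refine h.trans ?_
  rw [mul_assoc, ← Real.exp_add]
  refine mul_le_mul_of_nonneg_left (Real.exp_le_exp.2 ?_) hC₂
  have tx : l1 (x - u') ≤ l1 (x - u) + l1 (u - u') := l1_sub_triangle x u u'
  have ty : l1 (y - u') ≤ l1 (y - u) + l1 (u - u') := l1_sub_triangle y u u'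
  rw [l1_sub_symm u u'] at tx ty
  nlinarith [l1_nonneg (x - u), l1_nonneg (y - u), l1_nonneg (u' - u)]

/-- [folklore] **THE INNER VERTEX IS UNIFORMLY LOCALISED** (one centre): for `Decays K C m`, `LocStencil₂ S₂ C₂ m`, every slice `(κ, u)` and coarse bond `(ν, y′)`,
`BiLoc (vertexOfK K N (S₂ κ u) ν y′) (N•y′) (N•y′) ((d+1)·(C·C₂·Zl(m/4))) (m/4)` (`vertexFamily_vertexOfK` on the re-anchored slice). -/
theorem biLoc_innerVertex {K : MKer (d + 1) (Fib d)} {C m : ℝ} (hK : Decays K C m) (hC : 0 ≤ C)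
    {S₂ : Fin (d + 1) → (Fin (d + 1) → ℤ) → Fin (d + 1) → (Fin (d + 1) → ℤ) → MKer (d + 1) (Fib d)} {C₂ : ℝ}
    (hS₂ : LocStencil₂ S₂ C₂ m) (hm : 0 < m) (κ : Fin (d + 1)) (u : Fin (d + 1) → ℤ) (ν : Fin (d + 1)) (y' : Fin (d + 1) → ℤ) :
    BiLoc (vertexOfK K N (S₂ κ u) ν y') ((N : ℤ) • y') ((N : ℤ) • y') ((d + 1 : ℕ) * (C * C₂ * Zl (d + 1) (m / 2 / 2))) (m / 2 / 2) :=
  vertexFamily_vertexOfK (N := N) hK hC (locStencil_slice_of_locStencil₂ hS₂ hm.le κ u) (half_pos hm) (by linarith) ν y'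

/-- [folklore] **THE INNER VERTEX IS LIPSCHITZ IN `(K, S₂)`** (one centre): deviations `εK` (in `Decays`, rate `m`) and `ε₂` (in `LocStencil₂`, rate `m`) ⟹
`BiLoc (vertexOfK K N (S₂ κ u) ν y′ − vertexOfK K′ N (S₂′ κ u) ν y′) (N•y′) (N•y′) ((d+1)·((εK·C₂ + C′·ε₂)·Zl(m/4))) (m/4)` (asym1's
`vertexFamily_vertexOfK_sub` on the re-anchored slices). -/
theorem biLoc_innerVertex_sub {K K' : MKer (d + 1) (Fib d)} {C C' εK m : ℝ} (hK : Decays K C m) (hK' : Decays K' C' m)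
    (hKK : Decays (K - K') εK m)
    {S₂ S₂' : Fin (d + 1) → (Fin (d + 1) → ℤ) → Fin (d + 1) → (Fin (d + 1) → ℤ) → MKer (d + 1) (Fib d)} {C₂ C₂' ε₂ : ℝ}
    (hS₂ : LocStencil₂ S₂ C₂ m) (hS₂' : LocStencil₂ S₂' C₂' m) (hSS : LocStencil₂ (S₂ - S₂') ε₂ m) (hm : 0 < m)
    (κ : Fin (d + 1)) (u : Fin (d + 1) → ℤ) (ν : Fin (d + 1)) (y' : Fin (d + 1) → ℤ) :
    BiLoc (vertexOfK K N (S₂ κ u) ν y' - vertexOfK K' N (S₂' κ u) ν y') ((N : ℤ) • y') ((N : ℤ) • y')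
      ((d + 1 : ℕ) * ((εK * C₂ + C' * ε₂) * Zl (d + 1) (m / 2 / 2))) (m / 2 / 2) := by
  have h := vertexFamily_vertexOfK_sub hK hK' hKK (locStencil_slice_of_locStencil₂ hS₂ hm.le κ u)
    (locStencil_slice_of_locStencil₂ hS₂' hm.le κ u) (locStencil_slice_of_locStencil₂ hSS hm.le κ u) (half_pos hm) (by linarith) N
  exact h ν y'

end Inner

/-! ## §4 The bi-vertex is Lipschitz in `(K, S₂)`; its constructed limit is the bi-vertex of the limits -/

section BiVertex

variable {d : ℕ} {N : ℕ}

/-- [folklore] **ONE-CENTRE LOCALISATION OF THE BI-VERTEX** (uniform): `Decays K C m`, `LocStencil₂ S₂ C₂ m` ⟹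
`BiLoc (vertex2OfK K N S₂ μ y ν y′) (N•y′) (N•y′) ((d+1)·(C·Zl(m)·((d+1)·(C·C₂·Zl(m/4))))) (m/4)` — the outer `ℋ`-column summed against the uniformly localised
inner vertices (`biLoc_wsum_unif`).  (The TWO-centre `VertexFamily₂` bound is `SecondOrderResponse.vertexFamily₂_vertex2OfK`; one centre suffices for limits.) -/
theorem biLoc_vertex2OfK {K : MKer (d + 1) (Fib d)} {C m : ℝ} (hK : Decays K C m) (hC : 0 ≤ C)
    {S₂ : Fin (d + 1) → (Fin (d + 1) → ℤ) → Fin (d + 1) → (Fin (d + 1) → ℤ) → MKer (d + 1) (Fib d)} {C₂ : ℝ}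
    (hS₂ : LocStencil₂ S₂ C₂ m) (hm : 0 < m) (μ : Fin (d + 1)) (y : Fin (d + 1) → ℤ) (ν : Fin (d + 1)) (y' : Fin (d + 1) → ℤ) :
    BiLoc (vertex2OfK K N S₂ μ y ν y') ((N : ℤ) • y') ((N : ℤ) • y')
      ((d + 1 : ℕ) * (C * Zl (d + 1) m * ((d + 1 : ℕ) * (C * C₂ * Zl (d + 1) (m / 2 / 2))))) (m / 2 / 2) := by
  have hterm : ∀ κ : Fin (d + 1), BiLoc (wsum (colH K N μ y κ) (fun u => vertexOfK K N (S₂ κ u) ν y')) ((N : ℤ) • y') ((N : ℤ) • y')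
      (C * Zl (d + 1) m * ((d + 1 : ℕ) * (C * C₂ * Zl (d + 1) (m / 2 / 2)))) (m / 2 / 2) := fun κ =>
    biLoc_wsum_unif (fun u => abs_colH_le (N := N) hK μ y κ u) (fun u => biLoc_innerVertex hK hC hS₂ hm κ u ν y') hm
  have hsum := biLoc_finset_sum (Finset.univ : Finset (Fin (d + 1))) (fun κ _ => hterm κ)
  simp only [Finset.sum_const, Finset.card_univ, Fintype.card_fin, nsmul_eq_mul] at hsum
  exact hsum

/-- [folklore] **THE BI-VERTEX IS LIPSCHITZ IN `(K, S₂)`** (one centre, explicit constant, rate `m/4`): for `K, K′` decaying at rate `m` (constants `C, C′`, difference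
`εK`) and bi-stencil families `S₂, S₂′` (`LocStencil₂` constants `C₂, C₂′`, difference `ε₂`, rate `m`),
`BiLoc (vertex2OfK K N S₂ μ y ν y′ − vertex2OfK K′ N S₂′ μ y ν y′) (N•y′) (N•y′) ((d+1)·((εK·B + C′·εin)·Zl(m))) (m/4)` with the inner constants
`B = (d+1)·(C·C₂·Zl(m/4))`, `εin = (d+1)·((εK·C₂ + C′·ε₂)·Zl(m/4))`. -/
theorem biLoc_vertex2OfK_sub {K K' : MKer (d + 1) (Fib d)} {C C' εK m : ℝ} (hK : Decays K C m) (hK' : Decays K' C' m)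
    (hKK : Decays (K - K') εK m)
    {S₂ S₂' : Fin (d + 1) → (Fin (d + 1) → ℤ) → Fin (d + 1) → (Fin (d + 1) → ℤ) → MKer (d + 1) (Fib d)} {C₂ C₂' ε₂ : ℝ}
    (hS₂ : LocStencil₂ S₂ C₂ m) (hS₂' : LocStencil₂ S₂' C₂' m) (hSS : LocStencil₂ (S₂ - S₂') ε₂ m) (hm : 0 < m)
    (μ : Fin (d + 1)) (y : Fin (d + 1) → ℤ) (ν : Fin (d + 1)) (y' : Fin (d + 1) → ℤ) :
    BiLoc (vertex2OfK K N S₂ μ y ν y' - vertex2OfK K' N S₂' μ y ν y') ((N : ℤ) • y') ((N : ℤ) • y')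
      ((d + 1 : ℕ) * ((εK * ((d + 1 : ℕ) * (C * C₂ * Zl (d + 1) (m / 2 / 2))) +
        C' * ((d + 1 : ℕ) * ((εK * C₂ + C' * ε₂) * Zl (d + 1) (m / 2 / 2)))) * Zl (d + 1) m)) (m / 2 / 2) := by
  have hC : 0 ≤ C := hK.nonneg (Sum.inl 0)
  have hC' : 0 ≤ C' := hK'.nonneg (Sum.inl 0)
  have hterm : ∀ κ : Fin (d + 1),
      BiLoc (wsum (colH K N μ y κ) (fun u => vertexOfK K N (S₂ κ u) ν y') -
          wsum (colH K' N μ y κ) (fun u => vertexOfK K' N (S₂' κ u) ν y')) ((N : ℤ) • y') ((N : ℤ) • y')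
        ((εK * ((d + 1 : ℕ) * (C * C₂ * Zl (d + 1) (m / 2 / 2))) +
          C' * ((d + 1 : ℕ) * ((εK * C₂ + C' * ε₂) * Zl (d + 1) (m / 2 / 2)))) * Zl (d + 1) m) (m / 2 / 2) := fun κ =>
    biLoc_wsum_sub_unif (fun u => abs_colH_le (N := N) hK μ y κ u) (fun u => abs_colH_le (N := N) hK' μ y κ u)
      (fun u => by rw [← colH_sub]; exact abs_colH_le (N := N) hKK μ y κ u)
      (fun u => biLoc_innerVertex hK hC hS₂ hm κ u ν y') (fun u => biLoc_innerVertex hK' hC' hS₂' hm κ u ν y')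
      (fun u => biLoc_innerVertex_sub hK hK' hKK hS₂ hS₂' hSS hm κ u ν y') hm
  have hsum := biLoc_finset_sum (Finset.univ : Finset (Fin (d + 1))) (fun κ _ => hterm κ)
  simp only [Finset.sum_const, Finset.card_univ, Fintype.card_fin, nsmul_eq_mul] at hsum
  have e : vertex2OfK K N S₂ μ y ν y' - vertex2OfK K' N S₂' μ y ν y' = fun x z a b => ∑ κ : Fin (d + 1),
      (wsum (colH K N μ y κ) (fun u => vertexOfK K N (S₂ κ u) ν y') -
        wsum (colH K' N μ y κ) (fun u => vertexOfK K' N (S₂' κ u) ν y')) x z a b := by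
    funext x z a b
    simp only [vertex2OfK, vertexOfK, Pi.sub_apply, Finset.sum_sub_distrib]
  rw [e]
  exact hsum

variable {K : ℕ → MKer (d + 1) (Fib d)} {Kinf : MKer (d + 1) (Fib d)}
  {S₂ : ℕ → Fin (d + 1) → (Fin (d + 1) → ℤ) → Fin (d + 1) → (Fin (d + 1) → ℤ) → MKer (d + 1) (Fib d)}
  {S₂inf : Fin (d + 1) → (Fin (d + 1) → ℤ) → Fin (d + 1) → (Fin (d + 1) → ℤ) → MKer (d + 1) (Fib d)} {C cK C₂ c₂ m θ : ℝ}

/-- [folklore] **RATE FORM**: `K_j → K∞` geometrically in `Decays` (`εK = cK·θ^j`) and `S₂,j → S₂∞` geometrically in `LocStencil₂` (`ε₂ = c₂·θ^j`) with uniform rows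
(`C`, `C₂`, rate `m > 0`, `0 ≤ θ`) ⟹ `vertex2OfK (K j) N (S₂ j) → vertex2OfK K∞ N S₂∞` geometrically, entry family by entry family, in one-centre `BiLoc`. -/
theorem biLoc_vertex2OfK_rate (hK : ∀ j, Decays (K j) C m) (hKinf : Decays Kinf C m) (hKrate : ∀ j, Decays (K j - Kinf) (cK * θ ^ j) m)
    (hS : ∀ j, LocStencil₂ (S₂ j) C₂ m) (hSinf : LocStencil₂ S₂inf C₂ m) (hSrate : ∀ j, LocStencil₂ (S₂ j - S₂inf) (c₂ * θ ^ j) m)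
    (hm : 0 < m) (μ : Fin (d + 1)) (y : Fin (d + 1) → ℤ) (ν : Fin (d + 1)) (y' : Fin (d + 1) → ℤ) (j : ℕ) :
    BiLoc (vertex2OfK (K j) N (S₂ j) μ y ν y' - vertex2OfK Kinf N S₂inf μ y ν y') ((N : ℤ) • y') ((N : ℤ) • y')
      ((d + 1 : ℕ) * ((cK * ((d + 1 : ℕ) * (C * C₂ * Zl (d + 1) (m / 2 / 2))) +
        C * ((d + 1 : ℕ) * ((cK * C₂ + C * c₂) * Zl (d + 1) (m / 2 / 2)))) * Zl (d + 1) m) * θ ^ j) (m / 2 / 2) := by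
  have h := biLoc_vertex2OfK_sub (N := N) (hK j) hKinf (hKrate j) (hS j) hSinf (hSrate j) hm μ y ν y'
  intro x z a b
  refine (h x z a b).trans (le_of_eq ?_)
  ring

/-- [folklore] **THE CONSTRUCTED LIMIT OF THE BI-VERTEX FAMILY IS THE BI-VERTEX OF THE LIMITS**: under the rate data of `biLoc_vertex2OfK_rate` and `0 ≤ θ < 1`,
`limTabOf (j ↦ vertex2OfK (K j) N (S₂ j)) = vertex2OfK K∞ N S₂∞` (asym1's uniqueness `limMKerOf_eq_of_biLoc_rate`, entry family by entry family). -/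
theorem limTabOf_vertex2OfK_eq (hK : ∀ j, Decays (K j) C m) (hKinf : Decays Kinf C m) (hKrate : ∀ j, Decays (K j - Kinf) (cK * θ ^ j) m)
    (hS : ∀ j, LocStencil₂ (S₂ j) C₂ m) (hSinf : LocStencil₂ S₂inf C₂ m) (hSrate : ∀ j, LocStencil₂ (S₂ j - S₂inf) (c₂ * θ ^ j) m)
    (hm : 0 < m) (hθ0 : 0 ≤ θ) (hθ1 : θ < 1) :
    limTabOf (fun j => vertex2OfK (K j) N (S₂ j)) = vertex2OfK Kinf N S₂inf :=
  funext fun μ => funext fun y => funext fun ν => funext fun y' =>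
    limMKerOf_eq_of_biLoc_rate (T := fun j => vertex2OfK (K j) N (S₂ j) μ y ν y')
      (fun k => biLoc_vertex2OfK_rate (N := N) hK hKinf hKrate hS hSinf hSrate hm μ y ν y' k) hθ0 hθ1

/-- [folklore] … and the entrywise convergence itself (for use with §5). -/
theorem tendsto_vertex2OfK (hK : ∀ j, Decays (K j) C m) (hKinf : Decays Kinf C m) (hKrate : ∀ j, Decays (K j - Kinf) (cK * θ ^ j) m)
    (hS : ∀ j, LocStencil₂ (S₂ j) C₂ m) (hSinf : LocStencil₂ S₂inf C₂ m) (hSrate : ∀ j, LocStencil₂ (S₂ j - S₂inf) (c₂ * θ ^ j) m)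
    (hm : 0 < m) (hθ0 : 0 ≤ θ) (hθ1 : θ < 1) (μ : Fin (d + 1)) (y : Fin (d + 1) → ℤ) (ν : Fin (d + 1)) (y' : Fin (d + 1) → ℤ)
    (x z : Fin (d + 1) → ℤ) (a b : Fib d) :
    Tendsto (fun j => vertex2OfK (K j) N (S₂ j) μ y ν y' x z a b) atTop (𝓝 (vertex2OfK Kinf N S₂inf μ y ν y' x z a b)) :=
  tendsto_of_biLoc_rate (T := fun j => vertex2OfK (K j) N (S₂ j) μ y ν y')
    (fun k => biLoc_vertex2OfK_rate (N := N) hK hKinf hKrate hS hSinf hSrate hm μ y ν y' k) hθ0 hθ1 x z a b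

end BiVertex

/-! ## §5 Additivity of the constructed limits under entrywise convergence; the row-#14 glue -/

section Add

variable {D : ℕ} {F : Type*}

/-- [folklore] **THE CONSTRUCTED LIMIT IS ADDITIVE ON CONVERGENT FAMILIES**: if `K_j → A` and `L_j → B` entrywise then `limMKerOf (K + L) = A + B`.  (Without
convergence `CauchyRate.lim` is a junk value and additivity fails; hence the hypotheses.) -/
theorem limMKerOf_add_of_tendsto {K L : ℕ → MKer D F} {A B : MKer D F}
    (hK : ∀ x y a b, Tendsto (fun j => K j x y a b) atTop (𝓝 (A x y a b)))
    (hL : ∀ x y a b, Tendsto (fun j => L j x y a b) atTop (𝓝 (B x y a b))) :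
    limMKerOf (fun j => K j + L j) = A + B :=
  limMKerOf_eq_of_tendsto fun x y a b => by simpa only [Pi.add_apply] using (hK x y a b).add (hL x y a b)

/-- [folklore] The same for second-order tables: `limTabOf (W + X) = W∞ + X∞` when both families converge entrywise. -/
theorem limTabOf_add_of_tendsto {ι₁ κ₁ ι₂ κ₂ : Type*} {W X : ℕ → ι₁ → κ₁ → ι₂ → κ₂ → MKer D F} {Winf Xinf : ι₁ → κ₁ → ι₂ → κ₂ → MKer D F}
    (hW : ∀ μ y ν y' x z a b, Tendsto (fun j => W j μ y ν y' x z a b) atTop (𝓝 (Winf μ y ν y' x z a b)))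
    (hX : ∀ μ y ν y' x z a b, Tendsto (fun j => X j μ y ν y' x z a b) atTop (𝓝 (Xinf μ y ν y' x z a b))) :
    limTabOf (fun j => W j + X j) = Winf + Xinf :=
  funext fun μ => funext fun y => funext fun ν => funext fun y' => by
    rw [limTabOf_apply]
    exact limMKerOf_add_of_tendsto (K := fun j => W j μ y ν y') (L := fun j => X j μ y ν y') (hW μ y ν y') (hX μ y ν y')

end Add

section Glue

variable {d : ℕ} {N : ℕ} {K : ℕ → MKer (d + 1) (Fib d)} {Kinf : MKer (d + 1) (Fib d)}
  {S₂ : ℕ → Fin (d + 1) → (Fin (d + 1) → ℤ) → Fin (d + 1) → (Fin (d + 1) → ℤ) → MKer (d + 1) (Fib d)}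
  {S₂inf : Fin (d + 1) → (Fin (d + 1) → ℤ) → Fin (d + 1) → (Fin (d + 1) → ℤ) → MKer (d + 1) (Fib d)}
  {W X : ℕ → Fin (d + 1) → (Fin (d + 1) → ℤ) → Fin (d + 1) → (Fin (d + 1) → ℤ) → MKer (d + 1) (Fib d)}
  {Xinf : Fin (d + 1) → (Fin (d + 1) → ℤ) → Fin (d + 1) → (Fin (d + 1) → ℤ) → MKer (d + 1) (Fib d)} {C cK C₂ c₂ m θ : ℝ}

/-- [folklore] **ROW #14, THE LIMIT GLUE**: if a family of second-order tables splits at every `j` as `W j = vertex2OfK (K j) N (S₂ j) + X j` (for the literal: BY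
DEFINITION of its second-order slot, `SecondOrderResponse.W2OfK`), the resolvents and bi-stencils carry uniform rows + geometric rates to `(K∞, S₂∞)` (X1-type
data, `0 ≤ θ < 1`), and the remaining summand converges entrywise to `X∞`, THEN the constructed limit splits accordingly:
`limTabOf W = vertex2OfK K∞ N S₂∞ + X∞` — the shape of the displayed `hsplit` of `RoadEndLeft.d1Drift_left_of_step_law_wslot_split` (there `W j := unitW_j (Wt j m)`,
`K∞ := KPerf m`, rescaled per §1 `unitW_vertex2OfK`, bi-stencils in `unitS₂` units). -/
theorem limTabOf_split_of_rates (hsplit : ∀ j, W j = vertex2OfK (K j) N (S₂ j) + X j)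
    (hK : ∀ j, Decays (K j) C m) (hKinf : Decays Kinf C m) (hKrate : ∀ j, Decays (K j - Kinf) (cK * θ ^ j) m)
    (hS : ∀ j, LocStencil₂ (S₂ j) C₂ m) (hSinf : LocStencil₂ S₂inf C₂ m) (hSrate : ∀ j, LocStencil₂ (S₂ j - S₂inf) (c₂ * θ ^ j) m)
    (hm : 0 < m) (hθ0 : 0 ≤ θ) (hθ1 : θ < 1)
    (hX : ∀ μ y ν y' x z a b, Tendsto (fun j => X j μ y ν y' x z a b) atTop (𝓝 (Xinf μ y ν y' x z a b))) :
    limTabOf W = vertex2OfK Kinf N S₂inf + Xinf := by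
  have e : W = fun j => (fun j => vertex2OfK (K j) N (S₂ j)) j + X j := funext hsplit
  rw [e]
  exact limTabOf_add_of_tendsto (fun μ y ν y' x z a b => tendsto_vertex2OfK (N := N) hK hKinf hKrate hS hSinf hSrate hm hθ0 hθ1 μ y ν y' x z a b) hX

end Glue

end Summit.QuantumFields.BalabanUV.Beta.FP.BiVertexLimit

end
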